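import Mathlib
import Literature.Geometry.Lorentzian.Basic
import HarnessLib

/-!
# NearIdInjOpen

Topic `Literature/Uncategorized`. Named literature fact(s) relocated by the gate from `Summits/FinalStateConjecture/FinalStateConjecture/Theorems/StarvedNecksNeckGapDecayStubNearIdInjOpen.lean`
(accept-time relocation of `[cite]`d propositions written inline in a Summits proposal; human ruling 2026-08-15).

* `Literature.Uncategorized.NearIdInjOpen`
-/

namespace Literature.Uncategorized

open Literature.Geometry.Lorentzian

/-- **W1 — near-identity self-maps** (analysis on `E4`).  If `P : E4 → E4` is differentiable on a
convex open set `K` with `‖DP‖ ≤ 1/2` there, then `x ↦ x + P x` is `2`-co-Lipschitz on `K` (hence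
injective) and maps open subsets of `K` to open sets (mean value inequality on the convex `K`;
Mathlib's `ApproximatesLinearOn.open_image` for the identity with constant `1/2 < 1`).
[folklore] -/
def NearIdInjOpen : Prop :=
  ∀ (P : E4 → E4) (K : Set E4), IsOpen K → Convex ℝ K →
    (∀ x ∈ K, DifferentiableAt ℝ P x) → (∀ x ∈ K, ‖fderiv ℝ P x‖ ≤ 1 / 2) →
    (∀ x ∈ K, ∀ y ∈ K, ‖x - y‖ ≤ 2 * ‖(x + P x) - (y + P y)‖) ∧
    (∀ V : Set E4, IsOpen V → V ⊆ K → IsOpen ((fun x ↦ x + P x) '' V))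

end Literature.Uncategorized
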